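import Summits.BirchSwinnertonDyer.BirchSwinnertonDyer.Theorems.ManinLocalTwoThreeVeluThreeDiscriminant
import Summits.BirchSwinnertonDyer.BirchSwinnertonDyer.Theorems.ManinLocalTwoThreeTameThreeNeronScalarIIIstarVal
import Literature.NumberTheory.EllipticCurves.AnalyticIsogenyDescentProofs
import Literature.NumberTheory.EllipticCurves.IsogenyVariableChangeProofs
import HarnessLib

/-!
# The globally minimal carrier of the Vélu `3`-pair is `ℚ`-ISOGENOUS to `W`; E-an-107 / E-an-108 with the isogeny
# (`III → III*` by a `3`-isogeny of Néron scalar `u = 1`; `III* → III` by one of scalar `u = 3`)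

Summit `BirchSwinnertonDyer`, route `ManinLocalTwoThree` (cell bsd-f2-manin), deciding crux C3 `ManinPrimeToThreeAtNine`
(stmt-BirchSwinnertonDyer-22968).  The `3`-adic twin of `…VeluTwoIsogenous`; sequel of p644330 (dichotomy `k ∣ 3`), p645802 (every-prime
bookkeeping), p643391 / p643687 / p642603 (E-an-107.2, E-an-108.3, E-an-108.1).

* `exists_isIsogenous_dvd_three_velu_three` — for ANY globally minimal `W/ℚ` and `q` with `Ψ₃(q − b₂/12) = 0`: a globally minimal `W′`
  `ℚ`-ISOGENOUS to `W` (analytic descent `isIsogenous_of_forall_mul_mem_lattice` on `Λ_W ⊆ Λ_W + ℤz₀ = Λ_V`, `3z₀ ∈ Λ_W`) and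
  `k ∣ 3` with `k⁴c₄(W′), k⁶c₆(W′)` = the Vélu `3`-pair `(1440q² − 9c₄, 60480q³ − 756c₄q − 27c₆)`, plus the bookkeeping
  `ord_p Δ_min(W′) + 4·ord_p Ψ₂²(q − b₂/12) + 12·ord_p k = 3·ord_p Δ_min(W)` at every prime.
* `exists_isIsogenous_velu_three_of_III` — **E-an-107 with the isogeny:** `9 ∥ N`, `ord₃ Δ_min = 3` ⟹ an isogenous globally minimal
  `W′` carries the `u = 1` pair and has `ord₃ Δ_min(W′) = 9`.
* `exists_isIsogenous_three_velu_three_of_IIIstar` — **E-an-108 with the isogeny:** `9 ∥ N`, `ord₃ Δ_min = 9`, `ord₃ j ≥ 0` ⟹ an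
  isogenous globally minimal `W′` carries the pair divided by `(3⁴, 3⁶)` and has `ord₃ Δ_min(W′) = 3`.

HONEST FRAMING: C3, Manin's conjecture and BSD are not proved.  No definitions, no named facts, no sorry.
References: [SilvermanAEC2009] VI.4.1, VI.5.3, VIII.8.2; [SilvermanATAEC1994] IV.9.4 Table 4.1; [DokchitserDokchitser2015LocalInvariants]
Table 1; HOME/MEMO-an.md §66 (E-an-107/108).
-/

set_option autoImplicit false
set_option linter.dupNamespace false

noncomputable section

open scoped Classical
open Polynomial WeierstrassCurve
open Literature.NumberTheory.EllipticCurves Literature.NumberTheory.EllipticCurves.ModularForms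

namespace Summit.BirchSwinnertonDyer.BirchSwinnertonDyer.Theorems.ManinLocalTwoThree

/-! ### §1 The dichotomy at `3` with the isogeny -/

/-- **The dichotomy at `3` with the isogeny and the bookkeeping:** for ANY globally minimal `W/ℚ` and `q` with `Ψ₃(q − b₂/12) = 0` there
are a globally minimal `W′` `ℚ`-ISOGENOUS to `W` and `k ∣ 3` with `k⁴c₄(W′) = 1440q² − 9c₄`, `k⁶c₆(W′) = 60480q³ − 756c₄q − 27c₆`, and
`ord_p Δ_min(W′) + 4·ord_p Ψ₂²(q − b₂/12) + 12·ord_p k = 3·ord_p Δ_min(W)` at every prime.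
[cite: SilvermanAEC2009, Thm. VI.4.1, Thm. VI.5.3, VIII.8.2] [cite: DokchitserDokchitser2015LocalInvariants, Table 1] -/
theorem exists_isIsogenous_dvd_three_velu_three (W : WeierstrassCurve ℚ) [W.IsElliptic] [W.IsGloballyMinimal]
    (q : ℚ) (hq : W.Ψ₃.eval (q - W.b₂ / 12) = 0) :
    ∃ (W' : WeierstrassCurve ℚ) (k : ℤ) (_ : W'.IsElliptic) (_ : W'.IsGloballyMinimal), IsIsogenous W W' ∧ k ∣ 3 ∧ k ≠ 0 ∧
      (k : ℚ) ^ 4 * W'.c₄ = 1440 * q ^ 2 - 9 * W.c₄ ∧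
      (k : ℚ) ^ 6 * W'.c₆ = 60480 * q ^ 3 - 756 * W.c₄ * q - 27 * W.c₆ ∧
      ∀ (p : ℕ) [Fact p.Prime], (padicValInt p W'.minimalDiscriminantInt : ℤ) +
        4 * padicValRat p (W.Ψ₂Sq.eval (q - W.b₂ / 12)) + 12 * (padicValInt p k : ℤ) =
        3 * padicValInt p W.minimalDiscriminantInt := by
  set A : ℚ := 1440 * q ^ 2 - 9 * W.c₄ with hA
  set B : ℚ := 60480 * q ^ 3 - 756 * W.c₄ * q - 27 * W.c₆ with hB
  set V : WeierstrassCurve ℚ := ⟨0, 0, 0, -A / 48, -B / 864⟩ with hV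
  have hV4 : V.c₄ = A := by
    simp only [hV, WeierstrassCurve.c₄, WeierstrassCurve.b₂, WeierstrassCurve.b₄]; ring
  have hV6 : V.c₆ = B := by
    simp only [hV, WeierstrassCurve.c₆, WeierstrassCurve.b₂, WeierstrassCurve.b₄, WeierstrassCurve.b₆]; ring
  haveI hVell : V.IsElliptic := ⟨isUnit_iff_ne_zero.mpr (velu_three_Δ_ne_zero W q hq V hV4 hV6)⟩
  obtain ⟨C, hC⟩ := WeierstrassCurve.hasGlobalMinimalModel_rat_holds V
  haveI := hC
  set u : ℚ := (C.u : ℚ) with hu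
  have hu0 : u ≠ 0 := C.u.ne_zero
  have hW'4 : (C • V).c₄ = (u ^ 4)⁻¹ * A := by rw [variableChange_c₄, hV4, Units.val_inv_eq_inv_val, inv_pow]
  have hW'6 : (C • V).c₆ = (u ^ 6)⁻¹ * B := by rw [variableChange_c₆, hV6, Units.val_inv_eq_inv_val, inv_pow]
  haveI : (V.baseChange ℂ).IsElliptic := by rw [WeierstrassCurve.baseChange]; infer_instance
  haveI : (W.baseChange ℂ).IsElliptic := by rw [WeierstrassCurve.baseChange]; infer_instance
  haveI : ((C • V).baseChange ℂ).IsElliptic := by rw [WeierstrassCurve.baseChange]; infer_instance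
  obtain ⟨L₀, hL₀⟩ := exists_isNeronLatticeOf_holds (W.baseChange ℂ)
  obtain ⟨LV, hLV⟩ := exists_isNeronLatticeOf_holds (V.baseChange ℂ)
  obtain ⟨L', hL'⟩ := exists_isNeronLatticeOf_holds ((C • V).baseChange ℂ)
  have hΛ' : L'.lattice = (LV.mulLeft ((C.u : ℚ) : ℂ) (by exact_mod_cast C.u.ne_zero)).lattice :=
    IsNeronLatticeOf.lattice_eq_mulLeft_of_smul C hLV hL'
  obtain ⟨z₀, hz₀, hx₀, h3⟩ := exists_third_period_of_Ψ₃_root W hL₀ q hq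
  have hc₄W : (W.baseChange ℂ).c₄ = (W.c₄ : ℂ) := by simp [WeierstrassCurve.baseChange, WeierstrassCurve.map_c₄]
  have hc₆W : (W.baseChange ℂ).c₆ = (W.c₆ : ℂ) := by simp [WeierstrassCurve.baseChange, WeierstrassCurve.map_c₆]
  have hc₄V : (V.baseChange ℂ).c₄ = (V.c₄ : ℂ) := by simp [WeierstrassCurve.baseChange, WeierstrassCurve.map_c₄]
  have hc₆V : (V.baseChange ℂ).c₆ = (V.c₆ : ℂ) := by simp [WeierstrassCurve.baseChange, WeierstrassCurve.map_c₆]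
  have h₂ : LV.g₂ = 120 * L₀.weierstrassP z₀ ^ 2 - 9 * L₀.g₂ := by
    rw [hLV.1, hc₄V, hV4, hx₀, hL₀.1, hc₄W, hA]; push_cast; ring
  have h₃ : LV.g₃ = 280 * L₀.weierstrassP z₀ ^ 3 - 42 * L₀.g₂ * L₀.weierstrassP z₀ - 27 * L₀.g₃ := by
    rw [hLV.2, hc₆V, hV6, hx₀, hL₀.1, hL₀.2, hc₄W, hc₆W, hB]; push_cast; ring
  obtain ⟨hle, -, hidx⟩ := L₀.lattice_eq_of_velu_three_invariants hz₀ h3 LV h₂ h₃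
  -- THE ISOGENY `W ∼ V ∼ C • V` (analytic descent on `Λ_W ⊆ Λ_V`)
  have hisoV : IsIsogenous W V :=
    isIsogenous_of_forall_mul_mem_lattice hL₀.1 hL₀.2 hLV.1 hLV.2 (c := 1) one_ne_zero
      (fun z hz ↦ by rw [Rat.cast_one, one_mul]; exact hle hz)
  have hiso : IsIsogenous W (C • V) := hisoV.trans' (isIsogenous_smul V C)
  -- the Néron scaling divides 3
  have hu0' : (u : ℂ) ≠ 0 := by exact_mod_cast hu0
  have h3mul : ∀ w : ℂ, w ∈ L₀.lattice → 3 * w ∈ L₀.lattice := fun w hw ↦ by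
    have e : (3 : ℂ) * w = w + w + w := by ring
    rw [e]; exact add_mem (add_mem hw hw) hw
  have h3v : ∀ v : ℂ, v ∈ LV.lattice → 3 * v ∈ L₀.lattice := fun v hv ↦ by
    rcases hidx v hv with h | h | h
    · exact h3mul v h
    · have e : (3 : ℂ) * v = 3 * (v - z₀) + 3 * z₀ := by ring
      rw [e]; exact add_mem (h3mul _ h) h3
    · have e : (3 : ℂ) * v = 3 * (v + z₀) - 3 * z₀ := by ring
      rw [e]; exact sub_mem (h3mul _ h) h3
  have hμ : ∀ y ∈ L₀.lattice, ((u : ℚ) : ℂ) * y ∈ L'.lattice := fun y hy ↦ by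
    rw [hΛ']
    exact PeriodPair.mul_mem_mulLeft_lattice.mpr (hle hy)
  have hnμ : ∀ z ∈ L'.lattice, ∃ y ∈ L₀.lattice, ((3 : ℤ) : ℂ) * z = ((u : ℚ) : ℂ) * y := fun z hz ↦ by
    rw [hΛ', PeriodPair.mem_mulLeft_lattice] at hz
    refine ⟨3 * (((u : ℚ) : ℂ)⁻¹ * z), h3v _ hz, ?_⟩
    field_simp
    push_cast; ring
  obtain ⟨k, hk, hk3⟩ :=
    exists_int_eq_and_dvd_of_neronScaling W (C • V) L₀ L' hL₀ hL' u (n := 3) three_ne_zero hμ hnμ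
  have hk0 : k ≠ 0 := by rintro rfl; norm_num at hk3
  refine ⟨C • V, k, inferInstance, hC, hiso, hk3, hk0, ?_, ?_, fun p _ ↦ ?_⟩
  · rw [hW'4, hk]; field_simp
  · rw [hW'6, hk]; field_simp
  have hkQ : (k : ℚ) ≠ 0 := by exact_mod_cast hk0
  set C' : VariableChange ℚ := ⟨Units.mk0 ((k : ℚ)⁻¹) (inv_ne_zero hkQ), 0, 0, 0⟩ with hC'
  have hu' : ((C'.u⁻¹ : ℚˣ) : ℚ) = k := by rw [Units.val_inv_eq_inv_val, hC', Units.val_mk0, inv_inv]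
  have h4' : (k : ℚ) ^ 4 * (C • V).c₄ = A := by rw [hW'4, hk]; field_simp
  have h6' : (k : ℚ) ^ 6 * (C • V).c₆ = B := by rw [hW'6, hk]; field_simp
  have hS4 : (C' • (C • V)).c₄ = 1440 * q ^ 2 - 9 * W.c₄ := by rw [variableChange_c₄, hu', h4']
  have hS6 : (C' • (C • V)).c₆ = 60480 * q ^ 3 - 756 * W.c₄ * q - 27 * W.c₆ := by rw [variableChange_c₆, hu', h6']
  have hSΔ : (C' • (C • V)).Δ = (k : ℚ) ^ 12 * ((C • V).minimalDiscriminantInt : ℚ) := by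
    rw [variableChange_Δ, hu', cast_minimalDiscriminantInt]
  have hv := padicValRat_velu_three_Δ p W q hq (C' • (C • V)) hS4 hS6
  have hm0 : ((C • V).minimalDiscriminantInt : ℚ) ≠ 0 := by exact_mod_cast minimalDiscriminantInt_ne_zero (C • V)
  rw [hSΔ, padicValRat.mul (pow_ne_zero _ hkQ) hm0, padicValRat.pow (k : ℚ), ← cast_minimalDiscriminantInt W] at hv
  simp only [padicValRat.of_int] at hv
  push_cast at hv
  linarith

/-- The divisors of `3`: `k ∣ 3 ⟹ k ∈ {±1, ±3}`. -/
theorem eq_or_eq_of_int_dvd_three {k : ℤ} (hk : k ∣ 3) : (k = 1 ∨ k = -1) ∨ (k = 3 ∨ k = -3) := by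
  have hk3 : k.natAbs ∣ 3 := by simpa using Int.natAbs_dvd_natAbs.mpr hk
  rcases (Nat.dvd_prime Nat.prime_three).mp hk3 with h | h
  · left; omega
  · right; omega

/-! ### §2 E-an-107 / E-an-108 with the isogeny -/

/-- **E-an-107 with the isogeny (`III → III*`, `u = 1`):** `W` globally minimal, `9 ∥ N`, `ord₃ Δ_min = 3`, `Ψ₃(q − b₂/12) = 0` ⟹ a
globally minimal `W′` `ℚ`-isogenous to `W` has `c₄(W′) = 1440q² − 9c₄`, `c₆(W′) = 60480q³ − 756c₄q − 27c₆` and `ord₃ Δ_min(W′) = 9`.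
[cite: SilvermanATAEC1994, IV.9.4 Table 4.1] [cite: DokchitserDokchitser2015LocalInvariants, Table 1] -/
theorem exists_isIsogenous_velu_three_of_III (W : WeierstrassCurve ℚ) [W.IsElliptic] [W.IsGloballyMinimal]
    (h9 : 3 ^ 2 ∣ W.conductorNorm ℤ) (h27 : ¬ 3 ^ 3 ∣ W.conductorNorm ℤ)
    (hΔ : padicValInt 3 W.minimalDiscriminantInt = 3) (q : ℚ) (hq : W.Ψ₃.eval (q - W.b₂ / 12) = 0) :
    ∃ (W' : WeierstrassCurve ℚ) (_ : W'.IsElliptic) (_ : W'.IsGloballyMinimal), IsIsogenous W W' ∧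
      W'.c₄ = 1440 * q ^ 2 - 9 * W.c₄ ∧ W'.c₆ = 60480 * q ^ 3 - 756 * W.c₄ * q - 27 * W.c₆ ∧
      padicValInt 3 W'.minimalDiscriminantInt = 9 := by
  obtain ⟨W', k, hE', hM', hiso, hk, -, h4', h6', -⟩ := exists_isIsogenous_dvd_three_velu_three W q hq
  haveI := hE'; haveI := hM'
  rcases eq_or_eq_of_int_dvd_three hk with hk1 | hk3
  · have hk4 : (k : ℚ) ^ 4 = 1 := by rcases hk1 with rfl | rfl <;> norm_num
    have hk6 : (k : ℚ) ^ 6 = 1 := by rcases hk1 with rfl | rfl <;> norm_num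
    rw [hk4, one_mul] at h4'
    rw [hk6, one_mul] at h6'
    exact ⟨W', hE', hM', hiso, h4', h6',
      padicValInt_minimalDiscriminantInt_eq_nine_of_velu_three_of_III W h9 h27 hΔ q hq W' h4' h6'⟩
  · exfalso
    have hk4 : (k : ℚ) ^ 4 = 3 ^ 4 := by rcases hk3 with rfl | rfl <;> norm_num
    have hk6 : (k : ℚ) ^ 6 = 3 ^ 6 := by rcases hk3 with rfl | rfl <;> norm_num
    rw [hk4] at h4'
    rw [hk6] at h6'
    exact not_exists_isGloballyMinimal_three_velu_three_of_III W h9 h27 hΔ q hq ⟨W', hE', hM', h4', h6'⟩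

/-- **E-an-108 with the isogeny (`III* → III`, `u = 3`):** `W` globally minimal, `9 ∥ N`, `ord₃ Δ_min = 9`, `ord₃ j ≥ 0`,
`Ψ₃(q − b₂/12) = 0` ⟹ a globally minimal `W′` `ℚ`-isogenous to `W` has `3⁴c₄(W′) = 1440q² − 9c₄`, `3⁶c₆(W′) = 60480q³ − 756c₄q − 27c₆`
and `ord₃ Δ_min(W′) = 3`. [cite: SilvermanATAEC1994, IV.9.4 Table 4.1] [cite: DokchitserDokchitser2015LocalInvariants, Table 1] -/
theorem exists_isIsogenous_three_velu_three_of_IIIstar (W : WeierstrassCurve ℚ) [W.IsElliptic] [W.IsGloballyMinimal]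
    (h9 : 3 ^ 2 ∣ W.conductorNorm ℤ) (h27 : ¬ 3 ^ 3 ∣ W.conductorNorm ℤ)
    (hΔ : padicValInt 3 W.minimalDiscriminantInt = 9) (hj : 0 ≤ padicValRat 3 W.j)
    (q : ℚ) (hq : W.Ψ₃.eval (q - W.b₂ / 12) = 0) :
    ∃ (W' : WeierstrassCurve ℚ) (_ : W'.IsElliptic) (_ : W'.IsGloballyMinimal), IsIsogenous W W' ∧
      (3 : ℚ) ^ 4 * W'.c₄ = 1440 * q ^ 2 - 9 * W.c₄ ∧
      (3 : ℚ) ^ 6 * W'.c₆ = 60480 * q ^ 3 - 756 * W.c₄ * q - 27 * W.c₆ ∧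
      padicValInt 3 W'.minimalDiscriminantInt = 3 := by
  obtain ⟨W', k, hE', hM', hiso, hk, -, h4', h6', -⟩ := exists_isIsogenous_dvd_three_velu_three W q hq
  haveI := hE'; haveI := hM'
  rcases eq_or_eq_of_int_dvd_three hk with hk1 | hk3
  · exfalso
    have hk4 : (k : ℚ) ^ 4 = 1 := by rcases hk1 with rfl | rfl <;> norm_num
    have hk6 : (k : ℚ) ^ 6 = 1 := by rcases hk1 with rfl | rfl <;> norm_num
    rw [hk4, one_mul] at h4'
    rw [hk6, one_mul] at h6'
    exact not_exists_isGloballyMinimal_velu_three_of_IIIstar W h9 h27 hΔ hj q hq ⟨W', hE', hM', h4', h6'⟩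
  · have hk4 : (k : ℚ) ^ 4 = 3 ^ 4 := by rcases hk3 with rfl | rfl <;> norm_num
    have hk6 : (k : ℚ) ^ 6 = 3 ^ 6 := by rcases hk3 with rfl | rfl <;> norm_num
    rw [hk4] at h4'
    rw [hk6] at h6'
    exact ⟨W', hE', hM', hiso, h4', h6',
      padicValInt_minimalDiscriminantInt_eq_three_of_three_velu_three_of_IIIstar W h9 h27 hΔ hj q hq W' h4' h6'⟩

end Summit.BirchSwinnertonDyer.BirchSwinnertonDyer.Theorems.ManinLocalTwoThree

end
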